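/-
Copyright (c) 2026 the pub-hodgecm-mathlib formalisation cell (harness21).  Prover seat hodgecm-mathlib-B-p14 (g30), (F11) «ramified torus `(EL)¹ × E¹`», LAYER B′
step 1 (LEAD F0P3a-plan (g9) WORD T8-79 (4); architect A-p06 (g26)); frame of ★ (F1′)∕(C′) (B-p14 ∕ B-p17 (g24)), 2026-09-01.
-/
import Literature.NumberTheory.Automorphic.UnitaryThreeDoubleCosetsAnisotropicStabilizer   -- ★ p841385 (B-p17): (C′) the `(b,q,r,s)` shape of `Stab(w₀)` and the `H′_m` congruences
import HarnessLib

/-!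
# The anisotropic stabiliser `Stab(w₀) ≅ U(W)`, `W = w₀^⊥ = ⟨4ϖ⟩ ⊥ ⟨1⟩`: the unitarity relations in the `(b, q, r, s)` coordinates and the resulting valuation
# bounds (Flicker 1998, Prop. 4 p. 80 / p. 82: `H′ = U(2)_{aniso} × E¹`, `aā − πcc̄ = uū`) — LAYER B′ step 1 of Prop. 16's count

Topic `NumberTheory/Automorphic`; namespace `Literature.NumberTheory.Automorphic.UnitaryGroup`.  THEOREMS ONLY (no `def`, no instance, no notation, no named fact,
no `sorry`).  Cell `pub/hodgecm-mathlib`, crux H413 = `stmt-HodgeConjecture-24833`, line «N7nsCount» (value stub `stub_irredGValueNeg`), MAP v3 brick (F11),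
LAYER B′ (Flicker's Prop. 16 count) — STEP 1.  FRAME = ★ (F1′) p841283 ∕ ★ (C′) p841385: `K` with `Valued K ℤᵐ⁰`, ★ `LocalConjDatum σ ϖ`, `U = U(σ, Φ₃)`,
`w₀ = ![1, 0, −2ϖ]`, and an element `h ∈ U` fixing `w₀`, written (★ `exists_coe_eq_of_mulVec_anisoVec_eq`) as `!![1+2ϖb, q, b; 2ϖr, s, r; 4ϖ²b, 2ϖq, 1+2ϖb]`.

THE MATHEMATICS.  `h` preserves `W := w₀^⊥ = span(f₁, f₂)`, `f₁ = e₀ + 2ϖe₂ = ![1, 0, 2ϖ]`, `f₂ = e₁`, an ANISOTROPIC hermitian plane with Gram `diag(4ϖ, 1)`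
(`B₀ f₁ f₁ = 4ϖ`, `B₀ f₂ f₂ = 1`, `B₀ f₁ f₂ = 0`), and in that basis `h ↦ [[1 + 4ϖb, q], [4ϖr, s]]` (`mulVec_fOne`, `mulVec_fTwo`).  Unitarity of `h` is then the
three relations (§2) **(U1) `N(1+4ϖb) + 4ϖ·N(r) = 1`**, **(U2) `4ϖ·N(q) + N(s) = 1`**, **(U3) `4ϖ·σ(1+4ϖb)·q + 4ϖ·σ(r)·s = 0`** (`N(x) = σx·x`) — Flicker's
«`aā − πcc̄ = uū`».  Since `N(x)` has EVEN order and `4ϖ·N(y)` ODD order, no cancellation occurs in (U1)(U2) (§1 `v_eq_one_and_v_le_one_of_norm_add`), whence (§3)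
**`|s| = 1`, `|q| ≤ 1`, `|1 + 4ϖb| = 1`, `|r| ≤ 1`** for EVERY `h ∈ Stab(w₀)` — the compactness of `U(W)` in coordinates — and, with ★ (C′)
`flickerDiag_inv_mul_mul_flickerDiag_mem_unitaryInt_iff` at `m = 0`, **`h ∈ K₀ ↔ |b| ≤ 1`** (`mem_unitaryInt_iff_v_b_le_one`): the level-`0` subgroup `H′_0`
is cut out by the single coordinate `b` (`|b| ≤ |ϖ|⁻¹` in general).  These are the inputs of the coset parametrisation `Stab(w₀) ⧸ H′_m` in Prop. 16's count.
HONEST LABEL: HC_CM is proved only modulo the printed citations until rung 0 closes; structure theory, pays nothing by itself.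

## References
* [Flicker1998UnitaryFL] Y. Z. Flicker, *Elementary proof of the fundamental lemma for a unitary group*, Canad. J. Math. 50 (1998), Prop. 4 pp. 80–82, Prop. 16 p. 96.
* [Omeara1963] O. T. O'Meara, *Introduction to Quadratic Forms* (1963), §63 (local norms), §11 (domination).
-/

set_option autoImplicit false

noncomputable section

open scoped MatrixGroups WithZero
open Matrix

namespace Literature.NumberTheory.Automorphic

namespace UnitaryGroup

open Literature.NumberTheory.Automorphic.HermitianLattice

variable {K : Type*} [Field K] [Valued K ℤᵐ⁰] {ϖ : K}
  (σ : K →+* K) {J : Matrix (Fin 3) (Fin 3) K} (hJ : J = (StdForm.antidiagonal 3).over K)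

/-! ## §1 No cancellation between a norm and `4ϖ` times a norm -/

/-- **`N(x) + 4ϖ·N(y) = 1 ⇒ |x| = 1 ∧ |y| ≤ 1`** (`N(z) = σz·z`; `|σz| = |z|`, `|2| = 1`, `ϖ` a uniformiser): `N(x)` has even order, `4ϖN(y)` odd order, so the two
terms cannot cancel — the larger one has the valuation of the sum, `1`, and is therefore `N(x)`. [cite: Omeara1963, §11; §63] [cite: Flicker1998UnitaryFL, Prop. 16 p. 96] -/
theorem v_eq_one_and_v_le_one_of_norm_add (hd : LocalConjDatum σ ϖ) {x y : K} (h : σ x * x + 4 * ϖ * (σ y * y) = 1) :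
    Valued.v x = 1 ∧ Valued.v y ≤ 1 := by
  have hvσ := hd.vσ
  have h4 : Valued.v (4 : K) = 1 := by rw [show (4 : K) = 2 * 2 by norm_num, map_mul, hd.v2, one_mul]
  have hA : Valued.v (σ x * x) = Valued.v x * Valued.v x := by rw [map_mul, hvσ]
  have hB : Valued.v (4 * ϖ * (σ y * y)) = WithZero.exp (-1 : ℤ) * (Valued.v y * Valued.v y) := by
    rw [map_mul, map_mul, map_mul, h4, one_mul, hd.vϖ, hvσ]
  -- the parity obstruction: `|x|² ≠ q⁻¹ |y|²` unless `y = 0` and `x = 0` (impossible here)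
  have hne : ∀ {a b : K}, a ≠ 0 → Valued.v a * Valued.v a ≠ WithZero.exp (-1 : ℤ) * (Valued.v b * Valued.v b) := by
    intro a b ha heq
    have hva : Valued.v a ≠ 0 := (Valuation.ne_zero_iff _).2 ha
    by_cases hb : b = 0
    · rw [hb, map_zero, mul_zero, mul_zero] at heq
      exact hva (mul_self_eq_zero.1 heq)
    · have hvb : Valued.v b ≠ 0 := (Valuation.ne_zero_iff _).2 hb
      rw [← WithZero.exp_log hva, ← WithZero.exp_log hvb, ← WithZero.exp_add, ← WithZero.exp_add, ← WithZero.exp_add] at heq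
      have := WithZero.exp_injective heq
      omega
  by_cases hy : y = 0
  · subst hy
    simp only [map_zero, mul_zero, add_zero] at h
    refine ⟨?_, by rw [map_zero]; exact zero_le⟩
    have hv := congrArg Valued.v h
    rw [hA, map_one] at hv
    exact Literature.NumberTheory.QuadraticForms.OMeara65.WithZeroMulInt.eq_one_of_mul_self hv
  have hx : x ≠ 0 := by
    intro hx0
    rw [hx0, mul_zero, zero_add] at h
    have hv := congrArg Valued.v h
    rw [hB, map_one] at hv
    -- `q⁻¹|y|² = 1` is impossible by parity
    have hvy : Valued.v y ≠ 0 := (Valuation.ne_zero_iff _).2 hy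
    rw [← WithZero.exp_log hvy, ← WithZero.exp_add, ← WithZero.exp_add, ← WithZero.exp_zero] at hv
    have := WithZero.exp_injective hv
    omega
  -- ultrametric case analysis on which term dominates
  have hsum : Valued.v (σ x * x + 4 * ϖ * (σ y * y)) = 1 := by rw [h, map_one]
  rcases lt_trichotomy (Valued.v (σ x * x)) (Valued.v (4 * ϖ * (σ y * y))) with hlt | heq | hgt
  · -- the odd term dominates: then it has valuation 1 — parity contradiction
    exfalso
    rw [Valuation.map_add_eq_of_lt_right _ hlt] at hsum
    rw [hB] at hsum
    have hvy : Valued.v y ≠ 0 := (Valuation.ne_zero_iff _).2 hy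
    rw [← WithZero.exp_log hvy, ← WithZero.exp_add, ← WithZero.exp_add, ← WithZero.exp_zero] at hsum
    have := WithZero.exp_injective hsum
    omega
  · exact absurd (hA ▸ hB ▸ heq) (hne hx)
  · rw [Valuation.map_add_eq_of_lt_left _ hgt] at hsum
    rw [hA] at hsum
    have hx1 : Valued.v x = 1 := Literature.NumberTheory.QuadraticForms.OMeara65.WithZeroMulInt.eq_one_of_mul_self hsum
    refine ⟨hx1, ?_⟩
    -- `q⁻¹ |y|² < |x|² = 1` ⇒ `|y| ≤ 1`
    rw [hA, hx1, one_mul, hB] at hgt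
    by_contra hgt1
    rw [not_le] at hgt1
    have h1 : (1 : ℤᵐ⁰) ≤ WithZero.exp (-1 : ℤ) * (Valued.v y * Valued.v y) := by
      have hvy : Valued.v y ≠ 0 := (Valuation.ne_zero_iff _).2 hy
      obtain ⟨k, hk⟩ : ∃ k : ℤ, Valued.v y = WithZero.exp k := ⟨_, (WithZero.exp_log hvy).symm⟩
      rw [hk, ← WithZero.exp_zero, WithZero.exp_lt_exp] at hgt1
      rw [hk, ← WithZero.exp_add, ← WithZero.exp_add, ← WithZero.exp_zero, WithZero.exp_le_exp]
      omega
    exact (lt_irrefl _) (lt_of_le_of_lt h1 hgt)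

/-! ## §2 The plane `W = w₀^⊥ = span(f₁, f₂)` and the unitarity relations (U1)(U2)(U3) -/

omit [Valued K ℤᵐ⁰] in
/-- `h f₁ = (1 + 4ϖb)·f₁ + 4ϖr·f₂` for `f₁ = ![1, 0, 2ϖ]`, `f₂ = e₁`. [cite: Flicker1998UnitaryFL, Prop. 4 p. 82] -/
theorem stabilizer_mulVec_fOne {b q r s : K} (ϖ : K) :
    (!![1 + 2 * ϖ * b, q, b; 2 * ϖ * r, s, r; 4 * ϖ ^ 2 * b, 2 * ϖ * q, 1 + 2 * ϖ * b] : Matrix (Fin 3) (Fin 3) K) *ᵥ ![1, 0, 2 * ϖ] =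
      ![1 + 4 * ϖ * b, 4 * ϖ * r, 2 * ϖ * (1 + 4 * ϖ * b)] := by
  ext i
  fin_cases i <;> simp [Matrix.mulVec, dotProduct, Fin.sum_univ_three] <;> ring

omit [Valued K ℤᵐ⁰] in
/-- `h f₂ = q·f₁ + s·f₂`. [cite: Flicker1998UnitaryFL, Prop. 4 p. 82] -/
theorem stabilizer_mulVec_fTwo {b q r s : K} (ϖ : K) :
    (!![1 + 2 * ϖ * b, q, b; 2 * ϖ * r, s, r; 4 * ϖ ^ 2 * b, 2 * ϖ * q, 1 + 2 * ϖ * b] : Matrix (Fin 3) (Fin 3) K) *ᵥ ![0, 1, 0] =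
      ![q, s, 2 * ϖ * q] := by
  ext i
  fin_cases i <;> simp [Matrix.mulVec, dotProduct, Fin.sum_univ_three]

omit [Valued K ℤᵐ⁰] in
/-- `B₀` on vectors of the shape `![x, y, 2ϖx]` (the plane `W`): `B₀ ![x,y,2ϖx] ![x′,y′,2ϖx′] = 4ϖ·σx·x′ + σy·y′` (`σϖ = ϖ`) — Gram `diag(4ϖ, 1)`.
[cite: Flicker1998UnitaryFL, Prop. 4 p. 82] -/
theorem B₀_planeW (hσϖ : σ ϖ = ϖ) (x y x' y' : K) :
    B₀ σ 3 (![x, y, 2 * ϖ * x] : Fin 3 → K) ![x', y', 2 * ϖ * x'] = 4 * ϖ * (σ x * x') + σ y * y' := by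
  have r0 : Fin.rev (0 : Fin 3) = 2 := rfl
  have r1 : Fin.rev (1 : Fin 3) = 1 := rfl
  have r2 : Fin.rev (2 : Fin 3) = 0 := rfl
  simp [B₀_apply, Fin.sum_univ_three, r0, r1, r2, map_mul, hσϖ, map_ofNat]
  ring

include hJ in
/-- **THE UNITARITY RELATIONS OF `Stab(w₀)` IN THE `(b,q,r,s)` COORDINATES** — (U1) `N(1+4ϖb) + 4ϖN(r) = 1`, (U2) `4ϖN(q) + N(s) = 1`, (U3) `σ(1+4ϖb)·q + σ(r)·s = 0`
(Flicker's «`aā − πcc̄ = uū`» for `H′`).  [cite: Flicker1998UnitaryFL, Prop. 4 p. 80, p. 82] -/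
theorem stabilizer_unitarity_relations (hd : LocalConjDatum σ ϖ) {h : ↥(unitaryGroupOfForm σ J)} {b q r s : K}
    (hh : ((h : GL (Fin 3) K) : Matrix (Fin 3) (Fin 3) K) = !![1 + 2 * ϖ * b, q, b; 2 * ϖ * r, s, r; 4 * ϖ ^ 2 * b, 2 * ϖ * q, 1 + 2 * ϖ * b]) :
    σ (1 + 4 * ϖ * b) * (1 + 4 * ϖ * b) + 4 * ϖ * (σ r * r) = 1 ∧
      σ s * s + 4 * ϖ * (σ q * q) = 1 ∧ σ (1 + 4 * ϖ * b) * q + σ r * s = 0 := by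
  have hϖ0 := hd.ϖ_ne_zero
  have h20 : (2 : K) ≠ 0 := fun h0 => by have := hd.v2; rw [h0, map_zero] at this; exact zero_ne_one this
  have h4ϖ : (4 : K) * ϖ ≠ 0 := by rw [show (4 : K) = 2 * 2 by norm_num]; exact mul_ne_zero (mul_ne_zero h20 h20) hϖ0
  have hσϖ := hd.σϖ
  have hiso := B₀_mulVec_mulVec_of_mem σ hJ h
  have h11 := hiso ![1, 0, 2 * ϖ] ![1, 0, 2 * ϖ]
  have h22 := hiso ![0, 1, 0] ![0, 1, 0]
  have h12 := hiso ![1, 0, 2 * ϖ] ![0, 1, 0]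
  rw [hh, stabilizer_mulVec_fOne] at h11
  rw [hh, stabilizer_mulVec_fTwo] at h22
  rw [hh, stabilizer_mulVec_fOne, stabilizer_mulVec_fTwo] at h12
  have hf1 : (![(1 : K), 0, 2 * ϖ] : Fin 3 → K) = ![1, 0, 2 * ϖ * 1] := by simp
  have hf2 : (![(0 : K), 1, 0] : Fin 3 → K) = ![0, 1, 2 * ϖ * 0] := by simp
  rw [hf1] at h11 h12
  rw [hf2] at h22 h12
  rw [B₀_planeW σ hσϖ, B₀_planeW σ hσϖ] at h11 h22 h12
  simp only [map_one, map_zero, mul_one, mul_zero, add_zero, zero_add] at h11 h22 h12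
  refine ⟨?_, ?_, ?_⟩
  · -- (U1): divide `h11` by `4ϖ`
    apply mul_left_cancel₀ h4ϖ
    rw [map_mul, map_mul, map_ofNat, hσϖ] at h11
    linear_combination h11
  · linear_combination h22
  · apply mul_left_cancel₀ h4ϖ
    rw [map_mul, map_mul, map_ofNat, hσϖ] at h12
    linear_combination h12

/-! ## §3 Valuation bounds: `|s| = 1`, `|q| ≤ 1`, `|1 + 4ϖb| = 1`, `|r| ≤ 1`; `H′_0` is cut out by `|b| ≤ 1` -/

include hJ in
/-- **EVERY ELEMENT OF `Stab(w₀)` HAS `|s| = 1`, `|q| ≤ 1`, `|1 + 4ϖb| = 1`, `|r| ≤ 1`** (the compactness of the anisotropic `U(W)` in coordinates).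
[cite: Flicker1998UnitaryFL, Prop. 4 p. 82; Prop. 16 p. 96] -/
theorem stabilizer_valuation_bounds (hd : LocalConjDatum σ ϖ) {h : ↥(unitaryGroupOfForm σ J)} {b q r s : K}
    (hh : ((h : GL (Fin 3) K) : Matrix (Fin 3) (Fin 3) K) = !![1 + 2 * ϖ * b, q, b; 2 * ϖ * r, s, r; 4 * ϖ ^ 2 * b, 2 * ϖ * q, 1 + 2 * ϖ * b]) :
    Valued.v s = 1 ∧ Valued.v q ≤ 1 ∧ Valued.v (1 + 4 * ϖ * b) = 1 ∧ Valued.v r ≤ 1 := by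
  obtain ⟨hU1, hU2, -⟩ := stabilizer_unitarity_relations σ hJ hd hh
  obtain ⟨hs, hq⟩ := v_eq_one_and_v_le_one_of_norm_add σ hd hU2
  obtain ⟨hb, hr⟩ := v_eq_one_and_v_le_one_of_norm_add σ hd hU1
  exact ⟨hs, hq, hb, hr⟩

include hJ in
/-- **`Stab(w₀) ∩ K₀` is cut out by `|b| ≤ 1`**: for `h ∈ Stab(w₀)` in `(b,q,r,s)` coordinates, `h ∈ K₀ ↔ |b| ≤ 1` (the other three congruences of ★ (C′) at
`m = 0` are automatic by `stabilizer_valuation_bounds`).  [cite: Flicker1998UnitaryFL, Prop. 4 p. 82; Prop. 16 p. 96] -/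
theorem mem_unitaryInt_iff_v_b_le_one (hd : LocalConjDatum σ ϖ) {h d : ↥(unitaryGroupOfForm σ J)} {b q r s : K}
    (hd0 : ((d : GL (Fin 3) K) : Matrix (Fin 3) (Fin 3) K) = !![ϖ ^ 0, 0, 0; 0, 1, 0; 0, 0, (ϖ ^ 0)⁻¹])
    (hh : ((h : GL (Fin 3) K) : Matrix (Fin 3) (Fin 3) K) = !![1 + 2 * ϖ * b, q, b; 2 * ϖ * r, s, r; 4 * ϖ ^ 2 * b, 2 * ϖ * q, 1 + 2 * ϖ * b]) :
    h ∈ unitaryInt σ J ↔ Valued.v b ≤ 1 := by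
  obtain ⟨hs, hq, -, hr⟩ := stabilizer_valuation_bounds σ hJ hd hh
  have hd1 : d = 1 := by
    apply Subtype.ext; apply Units.ext
    rw [hd0, Subgroup.coe_one, Units.val_one]
    ext i j; fin_cases i <;> fin_cases j <;> simp
  have key := flickerDiag_inv_mul_mul_flickerDiag_mem_unitaryInt_iff σ hJ hd 0 hd0 hh
  rw [hd1, inv_one, one_mul, mul_one, pow_zero, map_one, one_mul] at key
  rw [key]
  exact ⟨fun H => H.2.1, fun H => ⟨hq, H, hr, hs.le⟩⟩

/-! ## §4 (ED. 2) The exponent `N` in coordinates: an odd-order discriminant forces `|q| = |ϖ|^N` and `|A − s| ≤ |ϖ|^{N+1}` -/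

/-- **PARITY SPLITTING OF THE DISCRIMINANT.**  For units `A, s` (`|A| = |s| = 1`) and any `q`, if `D := (A − s)² − 16ϖ·A·(σq·q)∕σs` — the discriminant `tr² − 4det` of the
`2×2` model `M_h = [[A, q],[4ϖr, s]]` of an element of `Stab(w₀)` (`det M_h = As − 4ϖrq`, `r = −Aσq∕σs`) — has ODD order `|D| = |ϖ|^{2N+1}`, then the odd-order term
dominates: **`|q| = |ϖ|^N`** and **`|A − s| ≤ |ϖ|^{N+1}`** (Flicker's `α = Bπ^N`, and `a ≡ ā`: the exponent `N` of a type-(2) element read in the anisotropic frame).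
[cite: Flicker1998UnitaryFL, Lemma 14 p. 94 (type (2): `α = Bπ^N`), Prop. 16 p. 96] -/
theorem v_q_eq_and_v_sub_le_of_v_disc (hd : LocalConjDatum σ ϖ) {A s q : K} (hA : Valued.v A = 1) (hs : Valued.v s = 1) (N : ℕ)
    (hD : Valued.v ((A - s) ^ 2 - 16 * ϖ * A * (σ q * q) / σ s) = WithZero.exp (-((2 * N + 1 : ℕ) : ℤ))) :
    Valued.v q = WithZero.exp (-(N : ℤ)) ∧ Valued.v (A - s) ≤ WithZero.exp (-((N : ℤ) + 1)) := by
  have hvσ := hd.vσ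
  have h16 : Valued.v (16 : K) = 1 := by
    rw [show (16 : K) = 2 * 2 * (2 * 2) by norm_num, map_mul, map_mul, hd.v2, one_mul, one_mul]
  have hσs : Valued.v (σ s) = 1 := by rw [hvσ, hs]
  have hσs0 : σ s ≠ 0 := ne_zero_of_v_eq_one hσs
  -- valuations of the two terms
  have hE : Valued.v ((A - s) ^ 2) = Valued.v (A - s) * Valued.v (A - s) := by rw [map_pow, pow_two]
  have hO : Valued.v (16 * ϖ * A * (σ q * q) / σ s) = WithZero.exp (-1 : ℤ) * (Valued.v q * Valued.v q) := by
    rw [map_div₀, map_mul, map_mul, map_mul, map_mul, h16, one_mul, hd.vϖ, hA, mul_one, hvσ, hσs, div_one]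
  by_cases hq : q = 0
  · -- then `D = (A − s)²` has even order (or is `0`): contradiction with the odd order
    exfalso
    rw [hq, map_zero, mul_zero, mul_zero, zero_div, sub_zero, hE] at hD
    by_cases hAs : A - s = 0
    · rw [hAs, map_zero, mul_zero] at hD; exact WithZero.coe_ne_zero hD.symm
    · have hv0 : Valued.v (A - s) ≠ 0 := (Valuation.ne_zero_iff _).2 hAs
      rw [← WithZero.exp_log hv0, ← WithZero.exp_add] at hD
      have := WithZero.exp_injective hD; omega
  have hvq : Valued.v q ≠ 0 := (Valuation.ne_zero_iff _).2 hq
  obtain ⟨k, hk⟩ : ∃ k : ℤ, Valued.v q = WithZero.exp k := ⟨_, (WithZero.exp_log hvq).symm⟩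
  rw [hk] at hO
  rcases lt_trichotomy (Valued.v ((A - s) ^ 2)) (Valued.v (16 * ϖ * A * (σ q * q) / σ s)) with hlt | heq | hgt
  · -- the odd term dominates: read off `k = −N`, then the even term is smaller
    rw [Valuation.map_sub_eq_of_lt_right _ hlt, hO, ← WithZero.exp_add, ← WithZero.exp_add] at hD
    have hkN : k = -(N : ℤ) := by have := WithZero.exp_injective hD; push_cast at this; omega
    refine ⟨by rw [hk, hkN], ?_⟩
    rw [hO, hE, hkN, ← WithZero.exp_add, ← WithZero.exp_add] at hlt
    by_cases hAs : A - s = 0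
    · rw [hAs, map_zero]; exact zero_le
    · have hv0 : Valued.v (A - s) ≠ 0 := (Valuation.ne_zero_iff _).2 hAs
      obtain ⟨j, hj⟩ : ∃ j : ℤ, Valued.v (A - s) = WithZero.exp j := ⟨_, (WithZero.exp_log hv0).symm⟩
      rw [hj, ← WithZero.exp_add, WithZero.exp_lt_exp] at hlt
      rw [hj, WithZero.exp_le_exp]
      omega
  · -- equal valuations: parity contradiction
    exfalso
    rw [hO, hE, ← WithZero.exp_add, ← WithZero.exp_add] at heq
    by_cases hAs : A - s = 0
    · rw [hAs, map_zero, mul_zero] at heq; exact WithZero.coe_ne_zero heq.symm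
    · have hv0 : Valued.v (A - s) ≠ 0 := (Valuation.ne_zero_iff _).2 hAs
      rw [← WithZero.exp_log hv0, ← WithZero.exp_add] at heq
      have := WithZero.exp_injective heq; omega
  · -- the even term dominates: then `D` has even order, contradiction
    exfalso
    rw [Valuation.map_sub_eq_of_lt_left _ hgt, hE] at hD
    by_cases hAs : A - s = 0
    · rw [hAs, map_zero, mul_zero] at hD; exact WithZero.coe_ne_zero hD.symm
    · have hv0 : Valued.v (A - s) ≠ 0 := (Valuation.ne_zero_iff _).2 hAs
      rw [← WithZero.exp_log hv0, ← WithZero.exp_add] at hD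
      have := WithZero.exp_injective hD; push_cast at this; omega

end UnitaryGroup

end Literature.NumberTheory.Automorphic

end
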